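import Literature.Analysis.FluidPDE.AgeDecouplingGridTrace
import Literature.Analysis.FluidPDE.AgeDecouplingGridPairing
import Literature.Analysis.FluidPDE.AgeDecouplingGridSums
import HarnessLib

/-!
# Grid age decoupling, IV: the deterministic data of the window inequality (traces and majorants)

Analysis/FluidPDE proof-support file (everything proved). The deterministic inputs of the finite-sum
assembly `AgeDecoupling.window_ineq_of_grid` (`FluidPDE/AgeDecouplingGridStep`) that concern ONE
release or the sourced scalar alone (no pairing):

* `IsWeakScalarTransportOn.releaseTrace_data` — for a release `R` of `h` into the drift `u(σ + ·)`
  on `[0, T_b)` with `∫ R² ≤ ∫ h²` a.e.: the trace `P_R` of `τ ↦ ∫ R(τ) h` is interval integrable,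
  has the explicit integrable modulus `k_R(r) = C_∇ (H₂ + ‖u(σ + r)‖²)/2 + κ C_Δ (1 + H₂)/2`
  (`H₂ = ∫ h²`), and `∫₀^ℓ k_R = c₀ ℓ + (C_∇/2) ∫_σ^{σ+ℓ} ‖u‖²`;
* `abs_trace_sub_le_integral_majorant`, `abs_sum_trace_sub_integral_le` — for the sourced scalar
  `θ`: the trace `P` of the power input has the integrable modulus
  `k_θ = C_∇ (‖θ‖² + ‖u‖²)/2 + κ C_Δ (1 + ‖θ‖²)/2 + H₂`, whence its left Riemann sums over grid cells
  are within `δ ∫ k_θ` of its integral (`AgeDecoupling.abs_sum_sub_integral_le`);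
* `integral_trace_le_integral_majorant` — `∫ₐᵇ P ≤ ∫ₐᵇ (1 + H₂‖θ‖²)/2` (`P² ≤ H₂ ‖θ‖²` a.e.).

## References

* R. J. DiPerna, P.-L. Lions, Invent. Math. 98 (1989), §II.1 (13)–(14). [`DiPernaLions1989`]
* T. D. Drivas, T. M. Elgindi, G. Iyer, I.-J. Jeong, ARMA 243 (2022), (1.1)–(1.3). [`DEIJ2022`]
-/

noncomputable section

open _root_.MeasureTheory _root_.Set _root_.Filter _root_.Function _root_.TopologicalSpace
open scoped ENNReal NNReal InnerProductSpace

namespace Literature.Analysis.FluidPDE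

namespace Torus

variable {d : Type*} [Fintype d]

/-! ## One release: the trace data -/

namespace IsWeakScalarTransportOn

variable {Tb κ σ Cg Cl : ℝ} {u : ℝ → UnitAddTorus d → EuclideanSpace ℝ d} {h : UnitAddTorus d → ℝ}
  {R : ℝ → UnitAddTorus d → ℝ}

/-- **The trace data of one release.** For `κ ≥ 0`, a release `R` of the smooth profile `h` into the
drift `u(σ + ·)` on `[0, T_b)` with `∫ R(τ)² ≤ ∫ h²` for a.e. `τ`, a drift with `t ↦ ∫ ‖u(t)‖²`
integrable on every `(0, T]`, and an age `ℓ ∈ [0, T_b]`: with `H₂ = ∫ h²` and the majorant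
`k_R(r) = C_∇ (H₂ + ∫‖u(σ + r)‖²)/2 + κ C_Δ (1 + H₂)/2`, (i) `k_R` and (ii) the trace
`P_R(s) = ∫ h² + ∫_{(0,s]} ∫ R (⟪u(σ + ·), ∇h⟫ + κΔh)` are interval integrable on `[0, ℓ]`,
(iii) `|P_R(s₂) - P_R(s₁)| ≤ ∫_{s₁}^{s₂} k_R` for `0 ≤ s₁ ≤ s₂ ≤ ℓ`, and
(iv) `∫₀^ℓ k_R = (C_∇ H₂/2 + κ C_Δ (1 + H₂)/2) ℓ + (C_∇/2) ∫_σ^{σ+ℓ} ‖u‖²`. [folklore] -/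
theorem releaseTrace_data (hκ : 0 ≤ κ) (hσ : 0 ≤ σ)
    (hR : IsWeakScalarTransportOn Tb κ (fun τ => u (σ + τ)) h R) (hh : FunctionSpaces.Torus.IsSmooth h)
    (hCg : ∀ x, ‖FunctionSpaces.Torus.gradient h x‖ ≤ Cg) (hCl : ∀ x, |FunctionSpaces.Torus.laplacian h x| ≤ Cl)
    (hsq : ∀ᵐ τ ∂((volume : Measure ℝ).restrict (Ioo 0 Tb)), ∫⁻ x, ‖R τ x‖ₑ ^ 2 ≤ eLpNorm h 2 volume ^ 2)
    (hEu : ∀ T, 0 < T → IntegrableOn (fun s => ∫ y, ‖u s y‖ ^ 2) (Ioc 0 T) volume)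
    {ℓ : ℝ} (hℓ0 : 0 ≤ ℓ) (hℓ : ℓ ≤ Tb) :
    IntervalIntegrable (fun r => Cg * ((∫ y, h y ^ 2) + ∫ y, ‖u (σ + r) y‖ ^ 2) / 2 +
        κ * Cl * (1 + ∫ y, h y ^ 2) / 2) volume 0 ℓ ∧
      IntervalIntegrable (fun s => (∫ y, h y * h y) + ∫ r in Ioc 0 s, ∫ y, R r y *
        (⟪u (σ + r) y, FunctionSpaces.Torus.gradient h y⟫_ℝ + κ * FunctionSpaces.Torus.laplacian h y)) volume 0 ℓ ∧
      (∀ s₁ s₂, 0 ≤ s₁ → s₁ ≤ s₂ → s₂ ≤ ℓ →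
        |((∫ y, h y * h y) + ∫ r in Ioc 0 s₂, ∫ y, R r y *
            (⟪u (σ + r) y, FunctionSpaces.Torus.gradient h y⟫_ℝ + κ * FunctionSpaces.Torus.laplacian h y)) -
          ((∫ y, h y * h y) + ∫ r in Ioc 0 s₁, ∫ y, R r y *
            (⟪u (σ + r) y, FunctionSpaces.Torus.gradient h y⟫_ℝ + κ * FunctionSpaces.Torus.laplacian h y))| ≤
          ∫ r in s₁..s₂, (Cg * ((∫ y, h y ^ 2) + ∫ y, ‖u (σ + r) y‖ ^ 2) / 2 + κ * Cl * (1 + ∫ y, h y ^ 2) / 2)) ∧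
      ∫ r in (0 : ℝ)..ℓ, (Cg * ((∫ y, h y ^ 2) + ∫ y, ‖u (σ + r) y‖ ^ 2) / 2 + κ * Cl * (1 + ∫ y, h y ^ 2) / 2) =
        (Cg * (∫ y, h y ^ 2) / 2 + κ * Cl * (1 + ∫ y, h y ^ 2) / 2) * ℓ +
          Cg / 2 * ∫ s in σ..(σ + ℓ), ∫ y, ‖u s y‖ ^ 2 := by
  set H₂ : ℝ := ∫ y, h y ^ 2 with hH₂
  set Eu : ℝ → ℝ := fun s => ∫ y, ‖u s y‖ ^ 2 with hEu_def
  set kr : ℝ → ℝ := fun r => Cg * (H₂ + Eu (σ + r)) / 2 + κ * Cl * (1 + H₂) / 2 with hkr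
  have hCg0 : 0 ≤ Cg := (norm_nonneg _).trans (hCg 0)
  have hCl0 : 0 ≤ Cl := (abs_nonneg _).trans (hCl 0)
  -- the translated energy is integrable on `(0, T_b)`
  have hEuT : IntegrableOn (fun r => Eu (σ + r)) (Ioo 0 Tb) volume := by
    refine integrableOn_Ioo_comp_add_left (F := Eu) ?_
    exact (hEu (σ + |Tb| + 1) (by positivity)).mono_set fun s hs => ⟨hσ.trans_lt hs.1, by linarith [hs.2, le_abs_self Tb]⟩
  have hkrT : IntegrableOn kr (Ioc 0 Tb) volume := by
    have h1 : IntegrableOn kr (Ioo 0 Tb) volume := by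
      have e : kr = fun r => (Cg * H₂ / 2 + κ * Cl * (1 + H₂) / 2) + (Cg / 2) * Eu (σ + r) := by
        funext r; simp only [hkr]; ring
      rw [e]
      exact (integrableOn_const measure_Ioo_lt_top.ne).add (hEuT.const_mul _)
    exact h1.congr_set_ae Ioo_ae_eq_Ioc.symm
  have hkri : IntervalIntegrable kr volume 0 ℓ :=
    (intervalIntegrable_iff_integrableOn_Ioc_of_le hℓ0).2 (hkrT.mono_set (Ioc_subset_Ioc_right hℓ))
  refine ⟨hkri, ?_, ?_, ?_⟩
  · -- the trace is continuous
    have hc := (continuousOn_releaseTrace hR hh).mono (Icc_subset_Icc_right hℓ)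
    exact hc.intervalIntegrable_of_Icc hℓ0
  · -- the modulus
    intro s₁ s₂ h0 h12 h2
    refine abs_releaseTrace_sub_le_of_ae_le hR hh hkrT ?_ h0 h12 (h2.trans hℓ)
    filter_upwards [ae_abs_releaseFlux_le hκ hR hCg hCl, hR.ae_memLp_two, hsq] with r h1 hm hs
    have hle : scalarL2Sq (R r) ≤ H₂ := scalarL2Sq_le_of_lintegral_le hm (hh.memLp 2) hs
    refine h1.trans ?_
    simp only [hkr, hEu_def]
    have hE0 : 0 ≤ ∫ y, ‖u (σ + r) y‖ ^ 2 := integral_nonneg fun _ => sq_nonneg _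
    have hκCl : 0 ≤ κ * Cl := mul_nonneg hκ hCl0
    nlinarith [mul_le_mul_of_nonneg_left hle hCg0, mul_le_mul_of_nonneg_left hle hκCl]
  · -- the integral of the majorant
    have e : kr = fun r => (Cg * H₂ / 2 + κ * Cl * (1 + H₂) / 2) + (Cg / 2) * Eu (σ + r) := by
      funext r; simp only [hkr]; ring
    have hEi : IntervalIntegrable (fun r => Eu (σ + r)) volume 0 ℓ :=
      (intervalIntegrable_iff_integrableOn_Ioo_of_le hℓ0).2 (hEuT.mono_set (Ioo_subset_Ioo_right hℓ))
    rw [e, intervalIntegral.integral_add intervalIntegrable_const (hEi.const_mul _), intervalIntegral.integral_const,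
      intervalIntegral.integral_const_mul, intervalIntegral.integral_comp_add_left (fun s => Eu s) σ]
    simp only [smul_eq_mul, sub_zero, add_zero]
    ring

end IsWeakScalarTransportOn

/-! ## The sourced scalar: the majorant of the trace modulus and of the trace -/

section Sourced

variable {κ Cg Cl : ℝ} {u : ℝ → UnitAddTorus d → EuclideanSpace ℝ d} {h θ₀ : UnitAddTorus d → ℝ}
  {θ : ℝ → UnitAddTorus d → ℝ}

/-- The majorant `k_θ(s) = C_∇ (‖θ(s)‖² + ‖u(s)‖²)/2 + κ C_Δ (1 + ‖θ(s)‖²)/2 + ∫h²` of the trace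
modulus is integrable on every `(0, T]`. [folklore] -/
theorem integrableOn_traceMajorant (hθ : IsWeakScalarTransportForced κ u (fun _ => h) θ₀ θ)
    (hEu : ∀ T, 0 < T → IntegrableOn (fun s => ∫ y, ‖u s y‖ ^ 2) (Ioc 0 T) volume) {T : ℝ} (hT : 0 < T) :
    IntegrableOn (fun s => Cg * (scalarL2Sq (θ s) + ∫ y, ‖u s y‖ ^ 2) / 2 +
      κ * Cl * (1 + scalarL2Sq (θ s)) / 2 + ∫ y, h y ^ 2) (Ioc 0 T) volume := by
  have he := (integrableOn_scalarL2Sq hθ hT).1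
  have hE := hEu T hT
  have h1 : IntegrableOn (fun _ : ℝ => (1 : ℝ)) (Ioc 0 T) volume := integrableOn_const measure_Ioc_lt_top.ne
  have hc : IntegrableOn (fun _ : ℝ => ∫ y, h y ^ 2) (Ioc 0 T) volume := integrableOn_const measure_Ioc_lt_top.ne
  exact ((((he.add hE).const_mul Cg).div_const 2).add (((h1.add he).const_mul (κ * Cl)).div_const 2)).add hc

/-- **The trace modulus against its majorant**: for `κ ≥ 0` and `0 ≤ s₁ ≤ s₂`,
`|P(s₂) - P(s₁)| ≤ ∫_{s₁}^{s₂} k_θ`. [folklore] -/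
theorem abs_trace_sub_le_integral_majorant (hκ : 0 ≤ κ)
    (hθ : IsWeakScalarTransportForced κ u (fun _ => h) θ₀ θ) (hh : FunctionSpaces.Torus.IsSmooth h)
    (hCg : ∀ x, ‖FunctionSpaces.Torus.gradient h x‖ ≤ Cg) (hCl : ∀ x, |FunctionSpaces.Torus.laplacian h x| ≤ Cl)
    (hEu : ∀ T, 0 < T → IntegrableOn (fun s => ∫ y, ‖u s y‖ ^ 2) (Ioc 0 T) volume)
    {s₁ s₂ : ℝ} (h0 : 0 ≤ s₁) (h12 : s₁ ≤ s₂) :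
    |((∫ y, θ₀ y * h y) + ∫ τ in Ioc 0 s₂, ((∫ y, θ τ y *
        (⟪u τ y, FunctionSpaces.Torus.gradient h y⟫_ℝ + κ * FunctionSpaces.Torus.laplacian h y)) + ∫ y, h y * h y)) -
      ((∫ y, θ₀ y * h y) + ∫ τ in Ioc 0 s₁, ((∫ y, θ τ y *
        (⟪u τ y, FunctionSpaces.Torus.gradient h y⟫_ℝ + κ * FunctionSpaces.Torus.laplacian h y)) + ∫ y, h y * h y))| ≤
      ∫ s in s₁..s₂, (Cg * (scalarL2Sq (θ s) + ∫ y, ‖u s y‖ ^ 2) / 2 +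
        κ * Cl * (1 + scalarL2Sq (θ s)) / 2 + ∫ y, h y ^ 2) := by
  refine (abs_trace_sub_le hθ hh h0 h12).trans ?_
  rcases eq_or_lt_of_le h12 with heq | hlt
  · subst heq; simp
  have hT : 0 < s₂ := h0.trans_lt hlt
  have hi1 : IntervalIntegrable (fun τ => |(∫ y, θ τ y *
      (⟪u τ y, FunctionSpaces.Torus.gradient h y⟫_ℝ + κ * FunctionSpaces.Torus.laplacian h y)) + ∫ y, h y * h y|) volume s₁ s₂ :=
    (intervalIntegrable_iff_integrableOn_Ioc_of_le h12).2 ((integrableOn_abs_traceDeriv hθ hh s₂).mono_set (Ioc_subset_Ioc_left h0))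
  have hi2 : IntervalIntegrable (fun s => Cg * (scalarL2Sq (θ s) + ∫ y, ‖u s y‖ ^ 2) / 2 +
      κ * Cl * (1 + scalarL2Sq (θ s)) / 2 + ∫ y, h y ^ 2) volume s₁ s₂ :=
    (intervalIntegrable_iff_integrableOn_Ioc_of_le h12).2 ((integrableOn_traceMajorant hθ hEu hT).mono_set (Ioc_subset_Ioc_left h0))
  refine intervalIntegral.integral_mono_ae_restrict h12 hi1 hi2 ?_
  have hsub : Icc s₁ s₂ ⊆ Ici 0 := fun s hs => h0.trans hs.1
  have hae : ∀ᵐ r ∂((volume : Measure ℝ).restrict (Ici 0)), |(∫ y, θ r y *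
      (⟪u r y, FunctionSpaces.Torus.gradient h y⟫_ℝ + κ * FunctionSpaces.Torus.laplacian h y)) + ∫ y, h y * h y| ≤
      Cg * (scalarL2Sq (θ r) + ∫ y, ‖u r y‖ ^ 2) / 2 + κ * Cl * (1 + scalarL2Sq (θ r)) / 2 + ∫ y, h y ^ 2 := by
    rw [← Measure.restrict_congr_set (Ioi_ae_eq_Ici (a := (0 : ℝ)))]
    exact ae_abs_traceDeriv_le hκ hθ hCg hCl
  exact ae_restrict_of_ae_restrict_of_subset hsub hae

/-- **Left Riemann sums of the trace over grid cells**: for `i₀ ≥ 1`,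
`|δ ∑_{j<L} P(δ(i₀ + j)) - ∫_{δi₀-δ}^{δi₀-δ+δL} P| ≤ δ ∫_{δi₀-δ}^{δi₀-δ+δL} k_θ`
(`AgeDecoupling.abs_sum_sub_integral_le` with the modulus `abs_trace_sub_le_integral_majorant`).
[folklore] -/
theorem abs_sum_trace_sub_integral_le (hκ : 0 ≤ κ)
    (hθ : IsWeakScalarTransportForced κ u (fun _ => h) θ₀ θ) (hh : FunctionSpaces.Torus.IsSmooth h)
    (hCg : ∀ x, ‖FunctionSpaces.Torus.gradient h x‖ ≤ Cg) (hCl : ∀ x, |FunctionSpaces.Torus.laplacian h x| ≤ Cl)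
    (hEu : ∀ T, 0 < T → IntegrableOn (fun s => ∫ y, ‖u s y‖ ^ 2) (Ioc 0 T) volume)
    {δ : ℝ} (hδ : 0 < δ) {i₀ : ℕ} (hi₀ : 1 ≤ i₀) (L : ℕ) :
    |δ * ∑ j ∈ Finset.range L, ((∫ y, θ₀ y * h y) + ∫ τ in Ioc 0 (δ * (i₀ + j)), ((∫ y, θ τ y *
        (⟪u τ y, FunctionSpaces.Torus.gradient h y⟫_ℝ + κ * FunctionSpaces.Torus.laplacian h y)) + ∫ y, h y * h y)) -
      ∫ x in (δ * i₀ - δ)..(δ * i₀ - δ + δ * L), ((∫ y, θ₀ y * h y) + ∫ τ in Ioc 0 x, ((∫ y, θ τ y *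
        (⟪u τ y, FunctionSpaces.Torus.gradient h y⟫_ℝ + κ * FunctionSpaces.Torus.laplacian h y)) + ∫ y, h y * h y))| ≤
      δ * ∫ s in (δ * i₀ - δ)..(δ * i₀ - δ + δ * L), (Cg * (scalarL2Sq (θ s) + ∫ y, ‖u s y‖ ^ 2) / 2 +
        κ * Cl * (1 + scalarL2Sq (θ s)) / 2 + ∫ y, h y ^ 2) := by
  have hCg0 : 0 ≤ Cg := (norm_nonneg _).trans (hCg 0)
  have hCl0 : 0 ≤ Cl := (abs_nonneg _).trans (hCl 0)
  have hx₀ : 0 ≤ δ * i₀ - δ := by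
    have : (1 : ℝ) ≤ i₀ := by exact_mod_cast hi₀
    nlinarith
  have hx₁ : δ * i₀ - δ ≤ δ * i₀ - δ + δ * L := le_add_of_nonneg_right (by positivity)
  have hT : 0 < δ * i₀ - δ + δ * L + 1 := by linarith
  refine AgeDecoupling.abs_sum_sub_integral_le
    (F := fun x => (∫ y, θ₀ y * h y) + ∫ τ in Ioc 0 x, ((∫ y, θ τ y *
        (⟪u τ y, FunctionSpaces.Torus.gradient h y⟫_ℝ + κ * FunctionSpaces.Torus.laplacian h y)) + ∫ y, h y * h y))
    (k := fun s => Cg * (scalarL2Sq (θ s) + ∫ y, ‖u s y‖ ^ 2) / 2 + κ * Cl * (1 + scalarL2Sq (θ s)) / 2 + ∫ y, h y ^ 2)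
    hδ i₀ L (fun s => ?_) ?_ ?_ (fun s₁ s₂ h1 h2 _ => ?_)
  · have h1 : 0 ≤ scalarL2Sq (θ s) := integral_nonneg fun _ => sq_nonneg _
    have h2 : 0 ≤ ∫ y, ‖u s y‖ ^ 2 := integral_nonneg fun _ => sq_nonneg _
    have h3 : 0 ≤ ∫ y, h y ^ 2 := integral_nonneg fun _ => sq_nonneg _
    positivity
  · exact (intervalIntegrable_iff_integrableOn_Ioc_of_le hx₁).2
      ((integrableOn_traceMajorant hθ hEu hT).mono_set (Ioc_subset_Ioc hx₀ (by linarith)))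
  · exact ((continuousOn_trace hθ hh _).mono (Icc_subset_Icc_left hx₀)).intervalIntegrable_of_Icc hx₁
  · exact abs_trace_sub_le_integral_majorant hκ hθ hh hCg hCl hEu (hx₀.trans h1) h2

/-- **The trace against its pointwise majorant**: `∫ₐᵇ P ≤ ∫ₐᵇ (1 + H₂ ‖θ‖²)/2` for `0 ≤ a ≤ b`
(`P² ≤ H₂‖θ‖²` a.e., `|P| ≤ (1 + P²)/2`). [folklore] -/
theorem integral_trace_le_integral_majorant
    (hθ : IsWeakScalarTransportForced κ u (fun _ => h) θ₀ θ) (hh : FunctionSpaces.Torus.IsSmooth h)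
    {a b : ℝ} (ha : 0 ≤ a) (hab : a ≤ b) :
    ∫ s in a..b, ((∫ y, θ₀ y * h y) + ∫ τ in Ioc 0 s, ((∫ y, θ τ y *
        (⟪u τ y, FunctionSpaces.Torus.gradient h y⟫_ℝ + κ * FunctionSpaces.Torus.laplacian h y)) + ∫ y, h y * h y)) ≤
      ∫ s in a..b, (1 + (∫ y, h y ^ 2) * scalarL2Sq (θ s)) / 2 := by
  rcases eq_or_lt_of_le hab with heq | hlt
  · subst heq; simp
  have hb : 0 < b := ha.trans_lt hlt
  have hi1 : IntervalIntegrable (fun s => (∫ y, θ₀ y * h y) + ∫ τ in Ioc 0 s, ((∫ y, θ τ y *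
      (⟪u τ y, FunctionSpaces.Torus.gradient h y⟫_ℝ + κ * FunctionSpaces.Torus.laplacian h y)) + ∫ y, h y * h y)) volume a b :=
    ((continuousOn_trace hθ hh b).mono (Icc_subset_Icc_left ha)).intervalIntegrable_of_Icc hab
  have hi2' : IntegrableOn (fun s => (1 + (∫ y, h y ^ 2) * scalarL2Sq (θ s)) / 2) (Ioc 0 b) volume :=
    ((integrableOn_const (measure_Ioc_lt_top (a := (0 : ℝ)) (b := b)).ne).add
      ((integrableOn_scalarL2Sq hθ hb).1.const_mul _)).div_const 2
  have hi2 : IntervalIntegrable (fun s => (1 + (∫ y, h y ^ 2) * scalarL2Sq (θ s)) / 2) volume a b :=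
    (intervalIntegrable_iff_integrableOn_Ioc_of_le hab).2 (hi2'.mono_set (Ioc_subset_Ioc_left ha))
  refine intervalIntegral.integral_mono_ae_restrict hab hi1 hi2 ?_
  have hsub : Icc a b ⊆ Ici 0 := fun s hs => ha.trans hs.1
  have hae : ∀ᵐ t ∂((volume : Measure ℝ).restrict (Ici 0)), ((∫ y, θ₀ y * h y) + ∫ τ in Ioc 0 t, ((∫ y, θ τ y *
      (⟪u τ y, FunctionSpaces.Torus.gradient h y⟫_ℝ + κ * FunctionSpaces.Torus.laplacian h y)) + ∫ y, h y * h y)) ≤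
      (1 + (∫ y, h y ^ 2) * scalarL2Sq (θ t)) / 2 := by
    rw [← Measure.restrict_congr_set (Ioi_ae_eq_Ici (a := (0 : ℝ)))]
    filter_upwards [ae_trace_sq_le hθ hh] with t ht
    nlinarith [ht, sq_nonneg (((∫ y, θ₀ y * h y) + ∫ τ in Ioc 0 t, ((∫ y, θ τ y *
      (⟪u τ y, FunctionSpaces.Torus.gradient h y⟫_ℝ + κ * FunctionSpaces.Torus.laplacian h y)) + ∫ y, h y * h y)) - 1)]
  exact ae_restrict_of_ae_restrict_of_subset hsub hae

end Sourced

end Torus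

end Literature.Analysis.FluidPDE
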